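import Literature.GroupTheory.FiniteAbelian.IsogenyPairParityFinite
import HarnessLib

/-!
# Stub `stub_finiteLevel` of line `toric-node-vacuity-cassels` (crux `PencilSelmerDictionary`)

The finite-level isogeny-pair parity statement, by name, for the skeleton of the crux
`Summit.Parity.BatemanHorn.Theses.IsogenyRedei.PencilSelmerDictionary` (stmt-Parity-11584): for
finite abelian `p`-groups `T`, `T'` with nondegenerate alternating pairings whose `p`-torsion
values embed in `𝔽_p`, and adjoint homomorphisms `f : T → T'`, `g : T' → T` with `g ∘ f = p`,
`f ∘ g = p`, one has `#ker f = p^m`, `#ker g = p^n` with `m + n` even. This is a one-line alias of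
the Literature theorem
`Literature.GroupTheory.FiniteAbelian.exists_natCard_ker_eq_pow_and_even_of_adjoint`
(file `Literature/GroupTheory/FiniteAbelian/IsogenyPairParityFinite.lean`), where the mathematics
lives; nothing arithmetic is used.
-/

noncomputable section

open scoped AddSubgroup

namespace Summit.Parity.BatemanHorn.Theorems.PencilSelmerDictionary

universe u v

/-- **Stub F1 — isogeny-pair parity at finite level.** Let `T`, `T'` be finite abelian `p`-groups
with bi-additive pairings `b`, `b'` (values in `Q`, whose `p`-torsion embeds in `𝔽_p` via `ι`)
which are alternating and nondegenerate, and let `f : T → T'`, `g : T' → T` satisfy `g ∘ f = p`,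
`f ∘ g = p` and `b'(f x, y) = b(x, g y)`. Then `#ker f = p^m`, `#ker g = p^n` with `m + n` even
(`Literature.GroupTheory.FiniteAbelian.exists_natCard_ker_eq_pow_and_even_of_adjoint`: square
orders `#T = p^{2i}`, `#T' = p^{2i'}` and the counting identity `#ker f · #T' = #T · #ker g`).
[folklore] -/
theorem stub_finiteLevel
    {T T' : Type u} {Q : Type v} [AddCommGroup T] [AddCommGroup T'] [AddCommGroup Q]
    [Finite T] [Finite T'] (p : ℕ) [Fact p.Prime]
    (hT : ∀ t : T, ∃ n : ℕ, p ^ n • t = 0) (hT' : ∀ t : T', ∃ n : ℕ, p ^ n • t = 0)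
    (ι : Q[(p : ℤ)] →+ ZMod p) (hι : Function.Injective ι)
    (b : T →+ T →+ Q) (b' : T' →+ T' →+ Q)
    (hb : ∀ x, b x x = 0) (hb' : ∀ y, b' y y = 0)
    (hbnd : ∀ x, (∀ y, b x y = 0) → x = 0) (hb'nd : ∀ x, (∀ y, b' x y = 0) → x = 0)
    (f : T →+ T') (g : T' →+ T)
    (hgf : ∀ x, g (f x) = p • x) (hfg : ∀ y, f (g y) = p • y)
    (hadj : ∀ x y, b' (f x) y = b x (g y)) :
    ∃ m n : ℕ, Nat.card f.ker = p ^ m ∧ Nat.card g.ker = p ^ n ∧ Even (m + n) :=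
  Literature.GroupTheory.FiniteAbelian.exists_natCard_ker_eq_pow_and_even_of_adjoint p hT hT' ι hι
    b b' hb hb' hbnd hb'nd f g hgf hfg hadj

end Summit.Parity.BatemanHorn.Theorems.PencilSelmerDictionary

end
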